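import Summits.BirchSwinnertonDyer.BirchSwinnertonDyer.Theorems.ThetaPartnerAtTwoMazurTateCongruenceAtTwoRDepletedPeriodLattice
import Summits.BirchSwinnertonDyer.BirchSwinnertonDyer.Theorems.ResidualThetaTransportAtTwoThetaLayerLambdaCongruenceAtTwoNoMazurKenku
import Summits.BirchSwinnertonDyer.BirchSwinnertonDyer.Theorems.ThetaPartnerAtTwoMazurTateCongruenceAtTwoRPlusLineThreeFacts
import HarnessLib

/-!
# Crux `MazurTateCongruenceAtTwoTop` (stmt-BirchSwinnertonDyer-25797 = `MazurTateCongruenceAtTwoR` 21416), line `symbol`: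
# THE PLUS LINE (C3k) WITHOUT THE ASSEMBLED EICHLER–SHIMURA FACT — `plusLineCharTwo_of_mcSdBz (hMC) (hSD) (hBz)`
# (width seat bsd-wall-tp2-p1-w2 g5; `--supports stmt-BirchSwinnertonDyer-25797`; THEOREMS ONLY — no `def`, no `sorry`; BSD is not proved)

PUB-REDUCTION. The plus line `plusLineCharTwo_of_threeFacts hES hSD hBz` (`…MazurTateCongruenceAtTwoRPlusLineThreeFacts`, tp2-p1-w4 g0) and
its source `kTwo_of_dvd_noMazur` (`…ThetaLayerLambdaCongruenceAtTwoNoMazurKenku`, rtt-p3-w3 g5) use the named fact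
`hES = eichlerShimura_depletedOptimalQuotient_periodLattice_of_dvd` — an ASSEMBLED statement (optimal quotient of `J₀(L)` attached to the
`S`-depleted oldform, its dimension, its period lattice AND its `a_p`; "no single printed statement") — at exactly one place, to get an elliptic
curve `A/ℚ` with Néron lattice `c·Λ_g` isogenous to `W`. That is now the tree theorem
`MazurTateCongruenceAtTwoR.DepletedLattice.exists_depletedLatticeCurve_isIsogenous` (p636031) GRANTED ONLY the mainstream fact
`hMC = IsNewformOf.exists_maninConstant_ne_zero` (BCDT 2001 (2)⇒(6): the newform of a modular elliptic curve `W` has `c₀Λ_f ⊆ Λ_W` for some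
`c₀ ≠ 0`; tree trust base = Eichler–Shimura congruence relation, `PeriodLatticeRationalityUnconditionalProofs`). This file re-threads the three
theorems of the chain with `hES ↦ hMC` (statements otherwise VERBATIM, proofs copied with the two lines replaced):
* `kTwo_of_dvd_noMC` — (K2) from `hMC`, `hSD` and the application input `hsub`;
* `kTwo_of_dvd_of_mcSdBz` — (K2) from {MC, SD, Bz};
* `plusLineCharTwo_of_mcSdBz` — **(C3k) in characteristic `2` from {MC, SD, Bz}**, conclusion of `plusLineCharTwo_of_fourFacts` /
  `_of_threeFacts` VERBATIM, so every consumer of the plus line (K1 `mazurTateCongruence_of_plusLine`, Kan⁺ `…_of_plusLineLevel_…`) may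
  replace the binder ES by MC: K1 ⟸ {MC, SD, Bz, AU} (companion file `…TopOfManinConstant`).
HONEST FRAMING: every theorem is CONDITIONAL on its displayed named facts; nothing closes an item; BSD is not proved by any of this.

References: [BCDTJAMS2001] p. 845; [Knapp1993] Thm. 11.74 (d); [CremonaAlgorithms1997] §2.4, §2.14; [Buzzard2000LevelLoweringModTwo]
Prop. 2.4; [DarmonDiamondTaylor1995] §1.6, §4.5.
-/

noncomputable section

-- justification: the `Summit.BirchSwinnertonDyer.BirchSwinnertonDyer.…` path repeats a component (route-file convention)
set_option linter.dupNamespace false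

open scoped MatrixGroups ComplexConjugate ModularForm NumberField Pointwise Classical
open CongruenceSubgroup Complex WeierstrassCurve IsDedekindDomain Polynomial Field Matrix Literature.NumberTheory.GaloisRepresentations
open Literature.NumberTheory.EllipticCurves Literature.NumberTheory.EllipticCurves.ModularForms
open Literature.NumberTheory.EllipticCurves.Rank1Residual Rat.HeightOneSpectrum
open Summit.BirchSwinnertonDyer.BirchSwinnertonDyer.Theses.ResidualThetaTransportAtTwo

namespace Summit.BirchSwinnertonDyer.BirchSwinnertonDyer.Theorems.ThetaLayerLambdaCongruenceAtTwo

/-! ## §1 (K2) at the crux's own level, from `hMC`, `hSD` and `hsub` -/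

/-- (ES-FREE re-threading of `kTwo_of_dvd_noMazur` (…`ThetaLayerLambdaCongruenceAtTwoNoMazurKenku`): the assembled named fact
`eichlerShimura_depletedOptimalQuotient_periodLattice_of_dvd` is REPLACED by `IsNewformOf.exists_maninConstant_ne_zero`, the optimal-quotient
curve `A` with `Λ_A = c·Λ_g` and `A ~ W` now coming from the tree theorem
`MazurTateCongruenceAtTwoR.DepletedLattice.exists_depletedLatticeCurve_isIsogenous` (so Faltings' `a_p` comparison is not needed either);
statement otherwise VERBATIM, proof copied with those lines replaced.) **ITEM B5 and (K2) at the crux's own level.** `W/ℚ` globally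
minimal, good supersingular at `2`, `Δ_W < 0`; newform `f` of level `N`; `S` a nonempty finite set of primes; a level `L` with
`N·∏_{ℓ∈S} ℓ² ∣ L` and `primes(L) ⊆ S`; `𝔪₀ = span{2, T_q − a_q(W) (q ∤ L), T_ℓ (ℓ ∣ L)}`. Inputs: `IsNewformOf.exists_maninConstant_ne_zero`,
Hecke self-duality of `J₀(L)[2]`, and `hsub` (conclusion of `buzzard2000_multiplicityOne_gamma0` at `𝔪₀`). Conclusion (K2): every additive
`K ⊇ 2Λ, (T_q^∨ − a_q(W))Λ, U_ℓ^∨Λ,` cusp-negation differences has `x, y ∈ Λ ∖ K ⇒ x − y ∈ K`.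
[cite: DarmonDiamondTaylor1995, §1.6 Lemma 1.38 and §4.5 Thm. 4.26] [cite: Knapp1993, Thm. 11.74 (d)] -/
theorem kTwo_of_dvd_noMC
    (hMC : IsNewformOf.exists_maninConstant_ne_zero)
    (hSD : heckeSelfDual_torsionBy_J0)
    (W : WeierstrassCurve ℚ) [W.IsElliptic] [W.IsGloballyMinimal] (hss : GoodSS W 2) (hΔ : W.Δ < 0)
    {N : ℕ} [NeZero N] {f : CuspForm (Gamma0 N) 2} (hf : IsNewformOf W f)
    (S : Finset ℕ) (hS : ∀ ℓ ∈ S, ℓ.Prime) (_hSne : S.Nonempty)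
    (L : ℕ) [NeZero L] (hNL : N * ∏ ℓ ∈ S, ℓ ^ 2 ∣ L) (hLS : ∀ p : ℕ, p.Prime → p ∣ L → p ∈ S)
    (hsub : Module.finrank (HeckeRing0 L 2 ⧸ Ideal.span ({t : HeckeRing0 L 2 | t = 2 ∨ (∃ (q : ℕ) (hq : q.Prime), ¬ q ∣ L ∧
          t = HeckeRing0.T L 2 q hq - (W.LFunction q : HeckeRing0 L 2)) ∨ (∃ (q : ℕ) (hq : q.Prime), q ∣ L ∧
          t = HeckeRing0.T L 2 q hq)}))
      (Submodule.torsionBySet (HeckeRing0 L 2) (J0 L) (Ideal.span ({t : HeckeRing0 L 2 | t = 2 ∨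
          (∃ (q : ℕ) (hq : q.Prime), ¬ q ∣ L ∧ t = HeckeRing0.T L 2 q hq - (W.LFunction q : HeckeRing0 L 2)) ∨
          (∃ (q : ℕ) (hq : q.Prime), q ∣ L ∧ t = HeckeRing0.T L 2 q hq)}))) = 2)
    (K : AddSubgroup (Module.Dual ℂ (CuspForm (Gamma0 L) 2)))
    (h2K : ∀ x ∈ periodHomology L, (2 : ℂ) • x ∈ K)
    (hTK : ∀ (q : ℕ) (hq : q.Prime), ¬ q ∣ L → ∀ x ∈ periodHomology L,
      (haveI : NeZero q := ⟨hq.ne_zero⟩; heckeT (Gamma0 L) 2 q).dualMap x - (W.LFunction q : ℂ) • x ∈ K)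
    (hUK : ∀ (q : ℕ) (hq : q.Prime), q ∣ L → ∀ x ∈ periodHomology L,
      (haveI : NeZero q := ⟨hq.ne_zero⟩; heckeT (Gamma0 L) 2 q).dualMap x ∈ K)
    (hcK : ∀ γ : Gamma0 L, periodFunctional L ⟨iotaConj (γ : SL(2, ℤ)), iotaConj_coe_mem_gamma0 γ⟩ - periodFunctional L γ ∈ K)
    {x y : Module.Dual ℂ (CuspForm (Gamma0 L) 2)} (hx : x ∈ periodHomology L) (hy : y ∈ periodHomology L)
    (hxK : x ∉ K) (hyK : y ∉ K) : x - y ∈ K := by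
  classical
  set G : Set (HeckeRing0 L 2) := {t : HeckeRing0 L 2 | t = 2 ∨ (∃ (q : ℕ) (hq : q.Prime), ¬ q ∣ L ∧
      t = HeckeRing0.T L 2 q hq - (W.LFunction q : HeckeRing0 L 2)) ∨ (∃ (q : ℕ) (hq : q.Prime), q ∣ L ∧
      t = HeckeRing0.T L 2 q hq)} with hGdef
  -- the depleted form at level `L`
  have hint : ∀ n : ℕ, ∃ z : ℤ, cuspCoeff f n = z := fun n ↦ ⟨W.LFunction n, hf.2 n⟩
  have hTf : ∀ (p : ℕ) (hp : p.Prime), (haveI : NeZero p := ⟨hp.ne_zero⟩; heckeT (Gamma0 N) 2 p f) = cuspCoeff f p • f :=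
    fun p hp ↦ by haveI : NeZero p := ⟨hp.ne_zero⟩; exact hf.1.heckeT_eq_coeff_smul hp
  have hLS' : ∀ p : ℕ, p.Prime → p ∣ L → p ∣ N ∨ p ∈ S := fun p hp h ↦ Or.inr (hLS p hp h)
  obtain ⟨g, hg', hgi, hgr, hg1, hgT, hgU, hgall⟩ := exists_depleted_eigenform_of_dvd f hint hf.1.2.2 hTf S hS L hNL hLS'
  have hg : ∀ n : ℕ, cuspCoeff g n = if ∃ ℓ ∈ S, ℓ ∣ n then 0 else (W.LFunction n : ℂ) := fun n ↦ by rw [hg' n, hf.2 n]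
  -- primes of `L` are exactly `S`
  have hSL : ∀ ℓ ∈ S, ℓ ∣ L := fun ℓ hℓ ↦ (dvd_level_of_mem (M := N) (S := S) rfl hℓ).trans hNL
  have hLiff : ∀ q : ℕ, q.Prime → (q ∣ L ↔ q ∈ S) := fun q hq ↦ ⟨hLS q hq, hSL q⟩
  -- the optimal quotient and `W ~ A`
  obtain ⟨A, hAell, hAmin, LA, c, hLA, hc, hlat, hiso⟩ :=
    MazurTateCongruenceAtTwoR.DepletedLattice.exists_depletedLatticeCurve_isIsogenous hMC W hf S hS L hNL g hg'
  obtain ⟨ψ, hcyc⟩ := hiso.exists_isCyclic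
  -- the eigen-ideal acts on `g` by even integers and contains `2`
  have h2 : (2 : HeckeRing0 L 2) ∈ Ideal.span G := Ideal.subset_span (Or.inl rfl)
  have hb : ∀ (q : ℕ) (hq : q.Prime), (haveI : NeZero q := ⟨hq.ne_zero⟩; heckeT (Gamma0 L) 2 q g) =
      (((if q ∈ S then 0 else W.LFunction q : ℤ)) : ℂ) • g := fun q hq ↦ by
    rw [hgall q hq, hg q]
    by_cases hqS : q ∈ S
    · rw [if_pos ⟨q, hqS, dvd_rfl⟩, if_pos hqS, Int.cast_zero]
    · rw [if_neg, if_neg hqS]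
      rintro ⟨ℓ, hℓ, hd⟩
      exact hqS (((Nat.prime_dvd_prime_iff_eq (hS ℓ hℓ) hq).mp hd) ▸ hℓ)
  have h𝔪 : ∀ t ∈ Ideal.span G, ∃ e : ℤ, HeckeRing0.toEnd L 2 t g = ((2 * e : ℤ) : ℂ) • g := by
    refine ideal_span_acts_even g (fun q ↦ if q ∈ S then 0 else W.LFunction q) hb G fun t ht ↦ ?_
    rcases ht with rfl | ⟨q, hq, hqL, rfl⟩ | ⟨q, hq, hqL, rfl⟩
    · exact Or.inl rfl
    · refine Or.inr ⟨q, hq, ?_⟩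
      rw [if_neg (fun h ↦ hqL ((hLiff q hq).mpr h))]
    · refine Or.inr ⟨q, hq, ?_⟩
      rw [if_pos ((hLiff q hq).mp hqL), Int.cast_zero, sub_zero]
  -- B5 at level `L`: a witness outside `𝔪₀Λ`, hence `𝔪₀ ≠ ⊤`, `|𝕋/𝔪₀| = 2`, maximal
  obtain ⟨γ₀, hγ₀⟩ := exists_periodFunctional_iotaConj_add_notMem_of_optimalQuotient W hss hΔ g hgr A hLA hc hlat ψ hcyc
    (Ideal.span G) h𝔪
  have hne : Ideal.span G ≠ ⊤ := by
    intro htop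
    apply hγ₀
    rw [htop, Submodule.top_smul]
    exact (mem_periodHomologyHecke L).mpr
      (add_mem (periodFunctional_mem_periodHomology L _) (periodFunctional_mem_periodHomology L γ₀))
  have hq := natCard_quotient_eq_two_of_ne_top (Ideal.span G) h2 (eigenIdeal_T_sub_int_mem W) hne
  haveI : (Ideal.span G).IsMaximal := isMaximal_of_natCard_quotient_eq_two _ hq
  -- B4 quotient form from `hsub` and the self-duality pairing, then the (K2) glue
  obtain ⟨B, hbal, hleft, -⟩ := hSD L 2
  obtain ⟨v₁, -, v₂, hv₂, hcos⟩ := exists_fourCosets_periodHomology_of_multiplicityOne _ h2 hq hsub B hbal hleft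
  have hK𝔪 : ∀ z ∈ Ideal.span G • periodHomologyHecke L, z ∈ K := by
    refine mem_of_mem_ideal_span_smul G K fun s hs z hz ↦ ?_
    rcases hs with rfl | ⟨q, hq', hqL, rfl⟩ | ⟨q, hq', hqL, rfl⟩
    · have : (2 : HeckeRing0 L 2) • z = (2 : ℂ) • z := by
        rw [show (2 : HeckeRing0 L 2) = ((2 : ℤ) : HeckeRing0 L 2) by norm_num, heckeRing0_intCast_smul, Int.cast_ofNat]
      rw [this]
      exact h2K z hz
    · rw [sub_smul, heckeRing0_T_smul, heckeRing0_intCast_smul]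
      exact hTK q hq' hqL z hz
    · rw [heckeRing0_T_smul]
      exact hUK q hq' hqL z hz
  exact indexTwo_of_fourCosets_of_optimalQuotient W hss hΔ g hgr A hLA hc hlat ψ hcyc (Ideal.span G) h2 h𝔪 K hK𝔪 hcK hv₂
    hcos hx hy hxK hyK

/-! ## §2 (K2) from {MC, SD, Bz} -/

/-- (ES-FREE re-threading of `kTwo_of_dvd_of_esSdBz` (…`MazurTateCongruenceAtTwoRPlusLineThreeFacts`): `hES` ↦
`hMC : IsNewformOf.exists_maninConstant_ne_zero`; statement otherwise VERBATIM.) **(K2) at the crux's own level from {MC, SD, Bz}**: for `W`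
globally minimal, `GoodSS W 2`, `Δ_W < 0`, newform `f` of level `N`, `S ≠ ∅` finite set of primes, `L` odd with `N·∏_{ℓ∈S} ℓ² ∣ L`,
`primes(L) ⊆ S`, good reduction at every `p ∤ 2L`: every additive `K ⊇ 2Λ, (T_q^∨ − a_q(W))Λ, U_ℓ^∨Λ,` cusp-negation differences has
`x, y ∈ Λ ∖ K ⇒ x − y ∈ K`. [cite: Buzzard2000LevelLoweringModTwo, Prop. 2.4 and Def. 2.1–2.2 (p. 100–101)]
[cite: DarmonDiamondTaylor1995, §1.6 Lemma 1.38 and §4.5 Thm. 4.26] -/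
theorem kTwo_of_dvd_of_mcSdBz
    (hMC : IsNewformOf.exists_maninConstant_ne_zero)
    (hSD : heckeSelfDual_torsionBy_J0) (hBz : buzzard2000_multiplicityOne_gamma0)
    (W : WeierstrassCurve ℚ) [W.IsElliptic] [W.IsGloballyMinimal] (hss : GoodSS W 2) (hΔ : W.Δ < 0)
    {N : ℕ} [NeZero N] {f : CuspForm (Gamma0 N) 2} (hf : IsNewformOf W f)
    (S : Finset ℕ) (hS : ∀ ℓ ∈ S, ℓ.Prime) (hSne : S.Nonempty)
    (L : ℕ) [NeZero L] (hL : Odd L) (hNL : N * ∏ ℓ ∈ S, ℓ ^ 2 ∣ L) (hLS : ∀ p : ℕ, p.Prime → p ∣ L → p ∈ S)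
    (hgood : ∀ v : HeightOneSpectrum (𝓞 ℚ), ¬ ((primesEquiv v : ℕ) ∣ 2 * L) → W.HasGoodReductionAt v)
    (K : AddSubgroup (Module.Dual ℂ (CuspForm (Gamma0 L) 2)))
    (h2K : ∀ x ∈ periodHomology L, (2 : ℂ) • x ∈ K)
    (hTK : ∀ (q : ℕ) (hq : q.Prime), ¬ q ∣ L → ∀ x ∈ periodHomology L,
      (haveI : NeZero q := ⟨hq.ne_zero⟩; heckeT (Gamma0 L) 2 q).dualMap x - (W.LFunction q : ℂ) • x ∈ K)
    (hUK : ∀ (q : ℕ) (hq : q.Prime), q ∣ L → ∀ x ∈ periodHomology L,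
      (haveI : NeZero q := ⟨hq.ne_zero⟩; heckeT (Gamma0 L) 2 q).dualMap x ∈ K)
    (hcK : ∀ γ : Gamma0 L, periodFunctional L ⟨iotaConj (γ : SL(2, ℤ)), iotaConj_coe_mem_gamma0 γ⟩ - periodFunctional L γ ∈ K)
    {x y : Module.Dual ℂ (CuspForm (Gamma0 L) 2)} (hx : x ∈ periodHomology L) (hy : y ∈ periodHomology L)
    (hxK : x ∉ K) (hyK : y ∉ K) : x - y ∈ K := by
  classical
  set G : Set (HeckeRing0 L 2) := {t : HeckeRing0 L 2 | t = 2 ∨ (∃ (q : ℕ) (hq : q.Prime), ¬ q ∣ L ∧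
      t = HeckeRing0.T L 2 q hq - (W.LFunction q : HeckeRing0 L 2)) ∨ (∃ (q : ℕ) (hq : q.Prime), q ∣ L ∧
      t = HeckeRing0.T L 2 q hq)} with hGdef
  by_cases hne : Ideal.span G = ⊤
  · -- vacuous case: `K ⊇ 𝔪₀Λ = Λ ∋ x`
    exfalso
    apply hxK
    have hK𝔪 : ∀ z ∈ Ideal.span G • periodHomologyHecke L, z ∈ K := by
      refine mem_of_mem_ideal_span_smul G K fun s hs z hz ↦ ?_
      rcases hs with rfl | ⟨q, hq', hqL, rfl⟩ | ⟨q, hq', hqL, rfl⟩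
      · have : (2 : HeckeRing0 L 2) • z = (2 : ℂ) • z := by
          rw [show (2 : HeckeRing0 L 2) = ((2 : ℤ) : HeckeRing0 L 2) by norm_num, heckeRing0_intCast_smul, Int.cast_ofNat]
        rw [this]
        exact h2K z hz
      · rw [sub_smul, heckeRing0_T_smul, heckeRing0_intCast_smul]
        exact hTK q hq' hqL z hz
      · rw [heckeRing0_T_smul]
        exact hUK q hq' hqL z hz
    apply hK𝔪
    rw [hne, Submodule.top_smul]
    exact (mem_periodHomologyHecke L).mpr hx
  · have h2 : (2 : HeckeRing0 L 2) ∈ Ideal.span G := Ideal.subset_span (Or.inl rfl)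
    have hq := natCard_quotient_eq_two_of_ne_top (Ideal.span G) h2 (eigenIdeal_T_sub_int_mem W) hne
    haveI h𝔪 : (Ideal.span G).IsMaximal := isMaximal_of_natCard_quotient_eq_two _ hq
    have hT : ∀ (q : ℕ) (hq' : q.Prime), ¬ q ∣ L →
        HeckeRing0.T L 2 q hq' - (W.LFunction q : HeckeRing0 L 2) ∈ Ideal.span G :=
      fun q hq' hqL ↦ Ideal.subset_span (Or.inr (Or.inl ⟨q, hq', hqL, rfl⟩))
    have hsub := finrank_torsionBySet_eq_two_of_buzzard hBz W hss L hL hgood (Ideal.span G) h𝔪 h2 hq hT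
    exact kTwo_of_dvd_noMC hMC hSD W hss hΔ hf S hS hSne L hNL hLS hsub K h2K hTK hUK hcK hx hy hxK hyK


/-! ## §3 (C3k) in characteristic `2` from {MC, SD, Bz} -/

/-- (ES-FREE form of `plusLineCharTwo_of_threeFacts`: `hES` ↦ `hMC : IsNewformOf.exists_maninConstant_ne_zero`; CONCLUSION VERBATIM.)
**(C3k) «plus multiplicity one over fields of characteristic `2`» at every level of the crux's shape, from {MC, SD, Bz}.** For `W` globally
minimal with `GoodSS W 2` and `Δ_W < 0`, an odd level `N'` with a newform `f` of `W` of level `N`, a nonempty finite set of primes `S` with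
`N·∏_{ℓ∈S} ℓ² ∣ N'`, `primes(N') ⊆ S` and good reduction at every `p ∤ 2N'`: for every field `k` of characteristic `2`, two nonzero even
`1`-periodic Γ₀(N')-symbol functions `Ψ₁, Ψ₂ : ℚ → k` that are exact Hecke eigenfunctions (`T_q ↦ a_q(W)`, `q ∤ N'`; `U_ℓ ↦ 0`, `ℓ ∣ N'`)
are proportional. Proof: `plusLineCharTwo_of_kTwo` with (K2) = `kTwo_of_dvd_of_mcSdBz`. BSD is not proved by this.
[cite: Buzzard2000LevelLoweringModTwo, Prop. 2.4 and Def. 2.1–2.2 (p. 100–101)] [cite: Manin1972, Thm. 1.9]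
[cite: DokchitserDokchitserMathZ2012, Theorem (1)] -/
theorem plusLineCharTwo_of_mcSdBz
    (hMC : IsNewformOf.exists_maninConstant_ne_zero)
    (hSD : heckeSelfDual_torsionBy_J0) (hBz : buzzard2000_multiplicityOne_gamma0) :
    ∀ (W : WeierstrassCurve ℚ) [W.IsElliptic] [W.IsGloballyMinimal], GoodSS W 2 → W.Δ < 0 → ∀ (N' : ℕ), Odd N' →
    ∀ {N : ℕ} [NeZero N] (f : CuspForm (Gamma0 N) 2), IsNewformOf W f →
    ∀ (S : Finset ℕ), (∀ ℓ ∈ S, ℓ.Prime) → S.Nonempty → N * ∏ ℓ ∈ S, ℓ ^ 2 ∣ N' → (∀ p : ℕ, p.Prime → p ∣ N' → p ∈ S) →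
    (∀ v : HeightOneSpectrum (𝓞 ℚ), ¬ ((primesEquiv v : ℕ) ∣ 2 * N') → W.HasGoodReductionAt v) →
    ∀ (k : Type) [Field k] [CharP k 2] (Ψ₁ Ψ₂ : ℚ → k), (∀ (r : ℚ) (z : ℤ), Ψ₁ (r + z) = Ψ₁ r) → (∀ r : ℚ, Ψ₁ (-r) = Ψ₁ r) → (∀ (γ : CongruenceSubgroup.Gamma0 (N')) (r : ℚ), ((γ : SL(2, ℤ)) 1 0 : ℚ) * r + ((γ : SL(2, ℤ)) 1 1 : ℚ) ≠ 0 → Ψ₁ ((((γ : SL(2, ℤ)) 0 0 : ℚ) * r + ((γ : SL(2, ℤ)) 0 1 : ℚ)) / (((γ : SL(2, ℤ)) 1 0 : ℚ) * r + ((γ : SL(2, ℤ)) 1 1 : ℚ))) = (if ((γ : SL(2, ℤ)) 1 0) = 0 then 0 else Ψ₁ ((((γ : SL(2, ℤ)) 0 0 : ℚ)) / (((γ : SL(2, ℤ)) 1 0 : ℚ)))) + Ψ₁ r) → (∀ (r : ℚ) (z : ℤ), Ψ₂ (r + z) = Ψ₂ r) → (∀ r : ℚ, Ψ₂ (-r)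 = Ψ₂ r) → (∀ (γ : CongruenceSubgroup.Gamma0 (N')) (r : ℚ), ((γ : SL(2, ℤ)) 1 0 : ℚ) * r + ((γ : SL(2, ℤ)) 1 1 : ℚ) ≠ 0 → Ψ₂ ((((γ : SL(2, ℤ)) 0 0 : ℚ) * r + ((γ : SL(2, ℤ)) 0 1 : ℚ)) / (((γ : SL(2, ℤ)) 1 0 : ℚ) * r + ((γ : SL(2, ℤ)) 1 1 : ℚ))) = (if ((γ : SL(2, ℤ)) 1 0) = 0 then 0 else Ψ₂ ((((γ : SL(2, ℤ)) 0 0 : ℚ)) / (((γ : SL(2, ℤ)) 1 0 : ℚ)))) + Ψ₂ r) → (∃ r : ℚ, Ψ₁ r ≠ 0) → (∃ r : ℚ, Ψ₂ r ≠ 0) → (∀ q : ℕ, q.Prime → ¬ q ∣ N' → ∀ r : ℚ, (∑ j : Fin q, Ψ₁ ((r + j) / q)) + Ψ₁ (q * r) = (W.LFunction q : k) * Ψ₁ r) → (∀ q : ℕ, q.Prime → ¬ q ∣ N' → ∀ r : ℚ, (∑ j : Fin q, Ψ₂ ((r + j) / q)) + Ψ₂ (q * r) = (W.LFunction q : k)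 * Ψ₂ r) → (∀ ℓ : ℕ, ℓ.Prime → ℓ ∣ N' → ∀ r : ℚ, ∑ j : Fin ℓ, Ψ₁ ((r + j) / ℓ) = 0) → (∀ ℓ : ℕ, ℓ.Prime → ℓ ∣ N' → ∀ r : ℚ, ∑ j : Fin ℓ, Ψ₂ ((r + j) / ℓ) = 0) → ∃ c : k, ∀ r : ℚ, Ψ₂ r = c * Ψ₁ r := by
  intro W _ _ hss hΔ N' hN' N _ f hf S hS hSne hNL hLS hgood k _ _ Ψ₁ Ψ₂ _ hev₁ hM₁ _ hev₂ hM₂ hne₁ _ hT₁ hT₂ hU₁ hU₂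
  haveI : NeZero N' := ⟨by rintro rfl; exact (Nat.not_even_iff_odd.mpr hN') (Even.zero)⟩
  have ha2 : ((W.LFunction 2 : ℤ) : k) = 0 := by
    rw [LFunction_apply_prime_eq_frobeniusTrace W 2 hss.1]
    obtain ⟨m, hm⟩ := hss.2
    rw [hm]
    push_cast
    rw [CharTwo.two_eq_zero, zero_mul]
  exact plusLineCharTwo_of_kTwo hN' (fun n ↦ W.LFunction n) ha2 Ψ₁ Ψ₂ hev₁ hM₁ hev₂ hM₂ hne₁ hT₁ hT₂ hU₁ hU₂
    (fun K h2K hTK hUK hcK x hx y hy hxK hyK ↦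
      kTwo_of_dvd_of_mcSdBz hMC hSD hBz W hss hΔ hf S hS hSne N' hN' hNL hLS hgood K h2K hTK hUK hcK hx hy hxK hyK)

end Summit.BirchSwinnertonDyer.BirchSwinnertonDyer.Theorems.ThetaLayerLambdaCongruenceAtTwo

end
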